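import Summits.NavierStokesRegularity.NavierStokesRegularity.Theorems.ExtremiserTransienceNearExtremalTransienceExtremiserLiouvilleConstantSpeedSlidePalinstrophyRemainder
import Summits.NavierStokesRegularity.NavierStokesRegularity.Theorems.ExtremiserTransienceNearExtremalTransienceExtremiserLiouvilleConstantSpeedSlidePairingTools
import Summits.NavierStokesRegularity.NavierStokesRegularity.Theorems.ExtremiserTransienceNearExtremalTransienceExtremiserLiouvilleConstantSpeedSlideWeightQuotient
import HarnessLib

/-!
# Crux `ExtremiserTransience.NearExtremalTransience` (stmt-NavierStokesRegularity-21883), line `extremiser_liouville`,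
# stub K1b — THE PALINSTROPHY BOUND ALONG THE SLIDE: remainders integrable, and the `h → 0⁺` limits (record §13, R3′/R4′)

`--supports stmt-NavierStokesRegularity-21883` (helper).  Author: prover seat `ns-el-k1b` (g9).

With `ψ_h = −h⁻¹φ̂_h`, `ω = curl V`, `Ψ = g(x₂)V`, `R = D(curl Ψ) − gDω`, `Kⱼ = ∂ⱼ(g′V₂)` (record §13):
* `integrable_palinstrophyRemainderR/T` : the two remainder integrands of `palinstrophy_slideQuotient_le` ARE integrable
  on a square-integrable layer (`R ∈ L²`, `DKⱼ ∈ L²`, …SlidePalinstrophyRemainder; pairings …SlidePairingTools), so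
* `palinstrophy_slideQuotient_le'` : **`c₁(ψ_h) ≤ −½∫(D₋ₕg)|Dω|²_F − ∫Σᵢ⟪∂ᵢω, h⁻¹(R − R(·−he₂))bᵢ⟫ + ∫Σᵢ⟪∂ᵢω, h⁻¹T_{bᵢ}⟫`**
  for EVERY `h > 0`, unconditionally;
* `tendsto_palinstrophy_slideQuotient_rhs` : **the right side tends, as `h → 0⁺`, to
  `ĉ₁ := −½∫g′|Dω|²_F − ∫Σᵢ⟪∂ᵢω, (∂₂R)bᵢ⟫ + ∫Σᵢ⟪∂ᵢω, (DK₁bᵢ)e₀ − (DK₀bᵢ)e₁⟫`** (the three limits R4′: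
  `D₋ₕg → g′` …SlideWeightQuotient, `h⁻¹(R − R(·−he₂)) → ∂₂R` …SlideTranslation, sliding averages …SlideAverage).
Hence `limsup_{h→0⁺} c₁(ψ_h) ≤ ĉ₁`; with `slideKKT` and the `a₁`/`J₁` limits this is (INEQ)₀ (next file).

WHAT THIS IS NOT: K1b is NOT proved; nothing here proves NS regularity. [folklore]
-/

noncomputable section

open Set Filter Topology MeasureTheory Metric Function InnerProductSpace
open scoped ENNReal NNReal Topology InnerProductSpace RealInnerProductSpace ContDiff
open Literature.Analysis.FluidPDE Literature.Analysis

namespace Summit.NavierStokesRegularity.NavierStokesRegularity.Theorems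

-- the problem directory repeats the summit name (`NavierStokesRegularity/NavierStokesRegularity`)
set_option linter.dupNamespace false

namespace ExtremiserLiouville

open DepletionLadder.KStar

variable {V : EuclideanSpace ℝ (Fin 3) → EuclideanSpace ℝ (Fin 3)} {g : ℝ → ℝ}

/-! ## 0. Small tools -/

/-- `(x − he₂)₂ = x₂ − h`. [folklore] -/
theorem coord_two_add_neg_smul_single (x : EuclideanSpace ℝ (Fin 3)) (h : ℝ) :
    (x + (-h) • EuclideanSpace.single (2 : Fin 3) (1 : ℝ)) 2 = x 2 - h := by
  simp [sub_eq_add_neg]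

/-- `Dω ∈ L²` for `D²V ∈ L²` (continuous, `‖Dω‖ ≤ 4‖D²V‖`). [folklore] -/
theorem memLp_fderiv_curl (hV : ContDiff ℝ ∞ V) (h2 : ∫⁻ x, ‖iteratedFDeriv ℝ 2 V x‖ₑ ^ 2 < ⊤) :
    Continuous (fderiv ℝ (curl V)) ∧ MemLp (fderiv ℝ (curl V)) 2 (volume : Measure (EuclideanSpace ℝ (Fin 3))) := by
  have hω : ContDiff ℝ ∞ (curl V) := contDiff_curl (n := ⊤) (hV.of_le (by exact_mod_cast le_top))
  have cD : Continuous (fderiv ℝ (curl V)) := hω.continuous_fderiv (by simp)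
  have hD2 : Integrable (fun x => ‖iteratedFDeriv ℝ 2 V x‖ ^ 2) (volume : Measure (EuclideanSpace ℝ (Fin 3))) :=
    integrable_sq_norm_of_lintegral (hV.continuous_iteratedFDeriv (WithTop.coe_le_coe.mpr le_top)) h2
  refine ⟨cD, memLp_two_of_norm_le_mul (K := 4) cD (hV.continuous_iteratedFDeriv (WithTop.coe_le_coe.mpr le_top)) hD2 fun x => ?_⟩
  have e1 : ‖iteratedFDeriv ℝ 0 (fderiv ℝ (curl V)) x‖ = ‖iteratedFDeriv ℝ 1 (curl V) x‖ := norm_iteratedFDeriv_fderiv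
  rw [norm_iteratedFDeriv_zero] at e1
  rw [e1]
  exact norm_iteratedFDeriv_curl_le_four hV 1 x

/-- Translates of a continuous `L²` map are in `L²`. [folklore] -/
theorem memLp_two_comp_add_right {F' : Type*} [NormedAddCommGroup F'] {f : EuclideanSpace ℝ (Fin 3) → F'}
    (hf : Continuous f) (hf2 : MemLp f 2 (volume : Measure (EuclideanSpace ℝ (Fin 3)))) (a : EuclideanSpace ℝ (Fin 3)) :
    MemLp (fun x => f (x + a)) 2 (volume : Measure (EuclideanSpace ℝ (Fin 3))) :=
  (memLp_two_iff_integrable_sq_norm (hf.comp (continuous_id.add continuous_const)).aestronglyMeasurable).2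
    ((integrable_sq_of_memLp_two hf2).comp_add_right a)

/-- `x ↦ (A x) ⊗ v` is continuous and in `L²` when `A` is (`‖c ⊗ v‖ = ‖c‖‖v‖`). [folklore] -/
theorem memLp_smulRight_const {A : EuclideanSpace ℝ (Fin 3) → (EuclideanSpace ℝ (Fin 3) →L[ℝ] ℝ)} (hA : Continuous A)
    (hA2 : MemLp A 2 (volume : Measure (EuclideanSpace ℝ (Fin 3)))) (v : EuclideanSpace ℝ (Fin 3)) :
    Continuous (fun x => (A x).smulRight v) ∧
      MemLp (fun x => (A x).smulRight v) 2 (volume : Measure (EuclideanSpace ℝ (Fin 3))) := by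
  have hc : Continuous fun x => (A x).smulRight v :=
    (isBoundedBilinearMap_smulRight (𝕜 := ℝ) (E := EuclideanSpace ℝ (Fin 3)) (F := EuclideanSpace ℝ (Fin 3))).continuous.comp
      (hA.prodMk continuous_const)
  refine ⟨hc, memLp_two_of_norm_le_mul (K := ‖v‖) hc hA (integrable_sq_of_memLp_two hA2) fun x => ?_⟩
  rw [ContinuousLinearMap.norm_smulRight_apply, mul_comm]

/-! ## 1. The remainder integrands are integrable (`hR`, `hT` of `palinstrophy_slideQuotient_le`) -/

/-- **`hR` holds**: `Σᵢ⟪∂ᵢω, h⁻¹(R(x) − R(x−he₂))bᵢ⟫` is integrable for every `h > 0`. [folklore] -/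
theorem integrable_palinstrophyRemainderR (hV : ContDiff ℝ ∞ V) (hg : ContDiff ℝ ∞ g) {T K1 K2 K3 : ℝ}
    (hK1 : ∀ s, |deriv g s| ≤ K1) (hK2 : ∀ s, |deriv (deriv g) s| ≤ K2) (hK3 : ∀ s, |deriv (deriv (deriv g)) s| ≤ K3)
    (hT2 : ∀ s, T < |s| → deriv (deriv g) s = 0) (hT3 : ∀ s, T < |s| → deriv (deriv (deriv g)) s = 0)
    (h1 : ∫⁻ x, ‖iteratedFDeriv ℝ 1 V x‖ₑ ^ 2 < ⊤) (h2 : ∫⁻ x, ‖iteratedFDeriv ℝ 2 V x‖ₑ ^ 2 < ⊤)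
    (hslab : Integrable (fun x => {x : EuclideanSpace ℝ (Fin 3) | |x 2| ≤ T}.indicator (fun x => ‖V x‖ ^ 2) x) volume)
    (h : ℝ) :
    Integrable (fun x => ∑ i : Fin 3, ⟪fderiv ℝ (curl V) x (EuclideanSpace.basisFun (Fin 3) ℝ i),
        h⁻¹ • ((fderiv ℝ (curl (fun z : EuclideanSpace ℝ (Fin 3) => g (z 2) • V z)) x (EuclideanSpace.basisFun (Fin 3) ℝ i) - g (x 2) • fderiv ℝ (curl V) x (EuclideanSpace.basisFun (Fin 3) ℝ i)) -
          (fderiv ℝ (curl (fun z : EuclideanSpace ℝ (Fin 3) => g (z 2) • V z)) (x + (-h) • EuclideanSpace.single (2 : Fin 3) (1 : ℝ)) (EuclideanSpace.basisFun (Fin 3) ℝ i) -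
            g (x 2 - h) • fderiv ℝ (curl V) (x + (-h) • EuclideanSpace.single (2 : Fin 3) (1 : ℝ)) (EuclideanSpace.basisFun (Fin 3) ℝ i)))⟫) (volume : Measure (EuclideanSpace ℝ (Fin 3))) := by
  set R : EuclideanSpace ℝ (Fin 3) → (EuclideanSpace ℝ (Fin 3) →L[ℝ] EuclideanSpace ℝ (Fin 3)) := fun y =>
    fderiv ℝ (curl (fun z : EuclideanSpace ℝ (Fin 3) => g (z 2) • V z)) y - g (y 2) • fderiv ℝ (curl V) y with hRdef
  have cR : Continuous R := (contDiff_curlRemainder hV hg).continuous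
  obtain ⟨mR, -⟩ := memLp_curlRemainder hV hg hK1 hK2 hK3 hT2 hT3 h1 h2 hslab
  obtain ⟨cD, mD⟩ := memLp_fderiv_curl hV h2
  have cRa : Continuous fun x => R (x + (-h) • EuclideanSpace.single (2 : Fin 3) (1 : ℝ)) :=
    cR.comp (continuous_id.add continuous_const)
  have cΨ : Continuous fun x => h⁻¹ • (R x - R (x + (-h) • EuclideanSpace.single (2 : Fin 3) (1 : ℝ))) :=
    (cR.sub cRa).const_smul h⁻¹
  have mΨ : MemLp (fun x => h⁻¹ • (R x - R (x + (-h) • EuclideanSpace.single (2 : Fin 3) (1 : ℝ)))) 2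
      (volume : Measure (EuclideanSpace ℝ (Fin 3))) :=
    (mR.sub (memLp_two_comp_add_right cR mR ((-h) • EuclideanSpace.single (2 : Fin 3) (1 : ℝ)))).const_smul h⁻¹
  refine (integrable_sum_inner_apply cD cΨ mD mΨ).congr (Eventually.of_forall fun x => ?_)
  refine Finset.sum_congr rfl fun i _ => ?_
  simp only [hRdef, smul_apply, sub_apply, coord_two_add_neg_smul_single]

/-- **`hT` holds**: `Σᵢ⟪∂ᵢω, h⁻¹T_{bᵢ}⟫` is integrable for every `h > 0`. [folklore] -/
theorem integrable_palinstrophyRemainderT (hV : ContDiff ℝ ∞ V) (hg : ContDiff ℝ ∞ g) {T K1 K2 K3 : ℝ}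
    (hK1 : ∀ s, |deriv g s| ≤ K1) (hK2 : ∀ s, |deriv (deriv g) s| ≤ K2) (hK3 : ∀ s, |deriv (deriv (deriv g)) s| ≤ K3)
    (hT2 : ∀ s, T < |s| → deriv (deriv g) s = 0) (hT3 : ∀ s, T < |s| → deriv (deriv (deriv g)) s = 0)
    (h1 : ∫⁻ x, ‖iteratedFDeriv ℝ 1 V x‖ₑ ^ 2 < ⊤) (h2 : ∫⁻ x, ‖iteratedFDeriv ℝ 2 V x‖ₑ ^ 2 < ⊤)
    (hslab : Integrable (fun x => {x : EuclideanSpace ℝ (Fin 3) | |x 2| ≤ T}.indicator (fun x => ‖V x‖ ^ 2) x) volume)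
    {h : ℝ} (hh : 0 < h) :
    Integrable (fun x => ∑ i : Fin 3, ⟪fderiv ℝ (curl V) x (EuclideanSpace.basisFun (Fin 3) ℝ i),
        h⁻¹ • ((∫ t in (-h)..0, fderiv ℝ (fun y : EuclideanSpace ℝ (Fin 3) => fderiv ℝ (fun z : EuclideanSpace ℝ (Fin 3) => deriv g (z 2) * V z 2) y (EuclideanSpace.single (1 : Fin 3) (1 : ℝ))) (x + t • EuclideanSpace.single (2 : Fin 3) (1 : ℝ)) (EuclideanSpace.basisFun (Fin 3) ℝ i)) • EuclideanSpace.single (0 : Fin 3) (1 : ℝ) -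
            (∫ t in (-h)..0, fderiv ℝ (fun y : EuclideanSpace ℝ (Fin 3) => fderiv ℝ (fun z : EuclideanSpace ℝ (Fin 3) => deriv g (z 2) * V z 2) y (EuclideanSpace.single (0 : Fin 3) (1 : ℝ))) (x + t • EuclideanSpace.single (2 : Fin 3) (1 : ℝ)) (EuclideanSpace.basisFun (Fin 3) ℝ i)) • EuclideanSpace.single (1 : Fin 3) (1 : ℝ))⟫) (volume : Measure (EuclideanSpace ℝ (Fin 3))) := by
  obtain ⟨cD, mD⟩ := memLp_fderiv_curl hV h2
  obtain ⟨c₁, m₁⟩ := memLp_fderiv_slideCoeffDeriv hV hg hK1 hK2 hK3 hT2 hT3 h1 h2 hslab (EuclideanSpace.single (1 : Fin 3) (1 : ℝ))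
  obtain ⟨c₀, m₀⟩ := memLp_fderiv_slideCoeffDeriv hV hg hK1 hK2 hK3 hT2 hT3 h1 h2 hslab (EuclideanSpace.single (0 : Fin 3) (1 : ℝ))
  obtain ⟨cA₁, mA₁⟩ := memLp_verticalAverage c₁ m₁ hh
  obtain ⟨cA₀, mA₀⟩ := memLp_verticalAverage c₀ m₀ hh
  obtain ⟨cΨ₁, mΨ₁⟩ := memLp_smulRight_const cA₁ mA₁ (EuclideanSpace.single (0 : Fin 3) (1 : ℝ))
  obtain ⟨cΨ₀, mΨ₀⟩ := memLp_smulRight_const cA₀ mA₀ (EuclideanSpace.single (1 : Fin 3) (1 : ℝ))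
  refine (integrable_sum_inner_apply cD (cΨ₁.sub cΨ₀) mD (mΨ₁.sub mΨ₀)).congr (Eventually.of_forall fun x => ?_)
  refine Finset.sum_congr rfl fun i _ => ?_
  have i₁ : IntervalIntegrable (fun t : ℝ => fderiv ℝ (fun y : EuclideanSpace ℝ (Fin 3) => fderiv ℝ (fun z : EuclideanSpace ℝ (Fin 3) => deriv g (z 2) * V z 2) y (EuclideanSpace.single (1 : Fin 3) (1 : ℝ))) (x + t • EuclideanSpace.single (2 : Fin 3) (1 : ℝ))) volume (-h) 0 :=
    (c₁.comp (continuous_const.add (continuous_id.smul continuous_const))).intervalIntegrable _ _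
  have i₀ : IntervalIntegrable (fun t : ℝ => fderiv ℝ (fun y : EuclideanSpace ℝ (Fin 3) => fderiv ℝ (fun z : EuclideanSpace ℝ (Fin 3) => deriv g (z 2) * V z 2) y (EuclideanSpace.single (0 : Fin 3) (1 : ℝ))) (x + t • EuclideanSpace.single (2 : Fin 3) (1 : ℝ))) volume (-h) 0 :=
    (c₀.comp (continuous_const.add (continuous_id.smul continuous_const))).intervalIntegrable _ _
  simp only [Pi.sub_apply, sub_apply, ContinuousLinearMap.smulRight_apply, smul_apply,
    ContinuousLinearMap.intervalIntegral_apply i₁, ContinuousLinearMap.intervalIntegral_apply i₀, smul_sub, smul_smul,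
    smul_eq_mul]

/-! ## 2. The three `h → 0⁺` limits (record §13, R4′) -/

/-- **(R4′a) `∫(D₋ₕg)|Dω|²_F → ∫g′|Dω|²_F`** (…SlideWeightQuotient with `ρ = |Dω|²_F ∈ L¹`). [folklore] -/
theorem tendsto_palinstrophyWeight (hV : ContDiff ℝ ∞ V) (hg : ContDiff ℝ ∞ g) {K1 K2 : ℝ}
    (hK1 : ∀ s, |deriv g s| ≤ K1) (hK2 : ∀ s, |deriv (deriv g) s| ≤ K2) (h2 : ∫⁻ x, ‖iteratedFDeriv ℝ 2 V x‖ₑ ^ 2 < ⊤) :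
    Tendsto (fun h : ℝ => ∫ x, (h⁻¹ * (g (x 2) - g (x 2 - h))) * frobeniusNormSq (fderiv ℝ (curl V) x)) (𝓝[>] 0)
      (𝓝 (∫ x, deriv g (x 2) * frobeniusNormSq (fderiv ℝ (curl V) x))) :=
  tendsto_integral_backwardQuotient_weight (hg.of_le (WithTop.coe_le_coe.mpr le_top)) hK1 hK2
    (integrable_frobeniusNormSq_fderiv_curl (hV.of_le (WithTop.coe_le_coe.mpr le_top)) h2).1

/-- **(R4′b) the remainder quotient passes to the limit**:
`∫Σᵢ⟪∂ᵢω, h⁻¹(R(x) − R(x−he₂))bᵢ⟫ → ∫Σᵢ⟪∂ᵢω, (∂₂R)(x)bᵢ⟫`, `R = D(curl(gV)) − gDω` (`∂₂R ∈ L²`, …SlideTranslation).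
[folklore] -/
theorem tendsto_palinstrophyRemainderR (hV : ContDiff ℝ ∞ V) (hg : ContDiff ℝ ∞ g) {T K1 K2 K3 : ℝ}
    (hK1 : ∀ s, |deriv g s| ≤ K1) (hK2 : ∀ s, |deriv (deriv g) s| ≤ K2) (hK3 : ∀ s, |deriv (deriv (deriv g)) s| ≤ K3)
    (hT2 : ∀ s, T < |s| → deriv (deriv g) s = 0) (hT3 : ∀ s, T < |s| → deriv (deriv (deriv g)) s = 0)
    (h1 : ∫⁻ x, ‖iteratedFDeriv ℝ 1 V x‖ₑ ^ 2 < ⊤) (h2 : ∫⁻ x, ‖iteratedFDeriv ℝ 2 V x‖ₑ ^ 2 < ⊤)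
    (hslab : Integrable (fun x => {x : EuclideanSpace ℝ (Fin 3) | |x 2| ≤ T}.indicator (fun x => ‖V x‖ ^ 2) x) volume) :
    Tendsto (fun h : ℝ => ∫ x, ∑ i : Fin 3, ⟪fderiv ℝ (curl V) x (EuclideanSpace.basisFun (Fin 3) ℝ i),
        h⁻¹ • ((fderiv ℝ (curl (fun z : EuclideanSpace ℝ (Fin 3) => g (z 2) • V z)) x (EuclideanSpace.basisFun (Fin 3) ℝ i) - g (x 2) • fderiv ℝ (curl V) x (EuclideanSpace.basisFun (Fin 3) ℝ i)) -
          (fderiv ℝ (curl (fun z : EuclideanSpace ℝ (Fin 3) => g (z 2) • V z)) (x + (-h) • EuclideanSpace.single (2 : Fin 3) (1 : ℝ)) (EuclideanSpace.basisFun (Fin 3) ℝ i) -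
            g (x 2 - h) • fderiv ℝ (curl V) (x + (-h) • EuclideanSpace.single (2 : Fin 3) (1 : ℝ)) (EuclideanSpace.basisFun (Fin 3) ℝ i)))⟫) (𝓝[>] 0)
      (𝓝 (∫ x, ∑ i : Fin 3, ⟪fderiv ℝ (curl V) x (EuclideanSpace.basisFun (Fin 3) ℝ i),
        (fderiv ℝ (fun y : EuclideanSpace ℝ (Fin 3) =>
          fderiv ℝ (curl (fun z : EuclideanSpace ℝ (Fin 3) => g (z 2) • V z)) y - g (y 2) • fderiv ℝ (curl V) y) x
          (EuclideanSpace.single (2 : Fin 3) (1 : ℝ))) (EuclideanSpace.basisFun (Fin 3) ℝ i)⟫)) := by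
  set R : EuclideanSpace ℝ (Fin 3) → (EuclideanSpace ℝ (Fin 3) →L[ℝ] EuclideanSpace ℝ (Fin 3)) := fun y =>
    fderiv ℝ (curl (fun z : EuclideanSpace ℝ (Fin 3) => g (z 2) • V z)) y - g (y 2) • fderiv ℝ (curl V) y with hRdef
  have hRs : ContDiff ℝ ∞ R := contDiff_curlRemainder hV hg
  have cR : Continuous R := hRs.continuous
  obtain ⟨mR, mDR⟩ := memLp_curlRemainder hV hg hK1 hK2 hK3 hT2 hT3 h1 h2 hslab
  obtain ⟨cD, mD⟩ := memLp_fderiv_curl hV h2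
  have cΨ : ∀ h : ℝ, Continuous fun x => h⁻¹ • (R x - R (x + (-h) • EuclideanSpace.single (2 : Fin 3) (1 : ℝ))) := fun h =>
    (cR.sub (cR.comp (continuous_id.add continuous_const))).const_smul h⁻¹
  have mΨ : ∀ h : ℝ, MemLp (fun x => h⁻¹ • (R x - R (x + (-h) • EuclideanSpace.single (2 : Fin 3) (1 : ℝ)))) 2
      (volume : Measure (EuclideanSpace ℝ (Fin 3))) := fun h =>
    (mR.sub (memLp_two_comp_add_right cR mR ((-h) • EuclideanSpace.single (2 : Fin 3) (1 : ℝ)))).const_smul h⁻¹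
  have cΨ₀ : Continuous fun x => fderiv ℝ R x (EuclideanSpace.single (2 : Fin 3) (1 : ℝ)) :=
    (hRs.continuous_fderiv (by simp)).clm_apply continuous_const
  have hlim := tendsto_lintegral_backwardQuotient_sub_fderiv (hRs.of_le (WithTop.coe_le_coe.mpr le_top)) mDR
  have key := tendsto_integral_sum_inner_apply (l := 𝓝[>] (0 : ℝ)) cD mD (Eventually.of_forall cΨ) (Eventually.of_forall mΨ)
    cΨ₀ mDR hlim
  refine key.congr fun h => integral_congr_ae (Eventually.of_forall fun x => ?_)
  refine Finset.sum_congr rfl fun i _ => ?_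
  simp only [hRdef, smul_apply, sub_apply, coord_two_add_neg_smul_single]

/-- `(a − c) ⊗ v = a ⊗ v − c ⊗ v`. [folklore] -/
theorem sub_smulRight (a c : EuclideanSpace ℝ (Fin 3) →L[ℝ] ℝ) (v : EuclideanSpace ℝ (Fin 3)) :
    (a - c).smulRight v = a.smulRight v - c.smulRight v := by
  ext w i
  simp [ContinuousLinearMap.smulRight_apply, sub_smul]

/-- One component of the `T`-term: `∫Σᵢ⟪∂ᵢω, (A_h(DK)(x)bᵢ)v⟫ → ∫Σᵢ⟪∂ᵢω, (DK(x)bᵢ)v⟫` for a continuous `L²` map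
`DK : ℝ³ → L(ℝ³, ℝ)` and its sliding averages `A_h(DK) = h⁻¹∫_{−h}^0 DK(· + te₂)dt`. [folklore] -/
theorem tendsto_integral_sum_inner_verticalAverage_smulRight (hV : ContDiff ℝ ∞ V)
    (h2 : ∫⁻ x, ‖iteratedFDeriv ℝ 2 V x‖ₑ ^ 2 < ⊤)
    {DK : EuclideanSpace ℝ (Fin 3) → (EuclideanSpace ℝ (Fin 3) →L[ℝ] ℝ)} (hc : Continuous DK)
    (hm : MemLp DK 2 (volume : Measure (EuclideanSpace ℝ (Fin 3)))) (v : EuclideanSpace ℝ (Fin 3)) :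
    Tendsto (fun h : ℝ => ∫ x, ∑ i : Fin 3, ⟪fderiv ℝ (curl V) x (EuclideanSpace.basisFun (Fin 3) ℝ i),
        ((h⁻¹ • ∫ t in (-h)..0, DK (x + t • EuclideanSpace.single (2 : Fin 3) (1 : ℝ))).smulRight v)
          (EuclideanSpace.basisFun (Fin 3) ℝ i)⟫) (𝓝[>] 0)
      (𝓝 (∫ x, ∑ i : Fin 3, ⟪fderiv ℝ (curl V) x (EuclideanSpace.basisFun (Fin 3) ℝ i),
        ((DK x).smulRight v) (EuclideanSpace.basisFun (Fin 3) ℝ i)⟫)) := by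
  set e₂ : EuclideanSpace ℝ (Fin 3) := EuclideanSpace.single (2 : Fin 3) (1 : ℝ) with he₂
  obtain ⟨cD, mD⟩ := memLp_fderiv_curl hV h2
  obtain ⟨cΨ₀, mΨ₀⟩ := memLp_smulRight_const hc hm v
  have hA : ∀ᶠ h : ℝ in 𝓝[>] 0, Continuous (fun x => h⁻¹ • ∫ t in (-h)..0, DK (x + t • e₂)) ∧
      MemLp (fun x => h⁻¹ • ∫ t in (-h)..0, DK (x + t • e₂)) 2 (volume : Measure (EuclideanSpace ℝ (Fin 3))) :=
    eventually_mem_nhdsWithin.mono fun h hh => memLp_verticalAverage hc hm hh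
  have hΨc : ∀ᶠ h : ℝ in 𝓝[>] 0, Continuous fun x => (h⁻¹ • ∫ t in (-h)..0, DK (x + t • e₂)).smulRight v :=
    hA.mono fun h hh => (memLp_smulRight_const hh.1 hh.2 v).1
  have hΨm : ∀ᶠ h : ℝ in 𝓝[>] 0, MemLp (fun x => (h⁻¹ • ∫ t in (-h)..0, DK (x + t • e₂)).smulRight v) 2
      (volume : Measure (EuclideanSpace ℝ (Fin 3))) :=
    hA.mono fun h hh => (memLp_smulRight_const hh.1 hh.2 v).2
  have hlim0 := tendsto_lintegral_verticalAverage_sub hc hm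
  have hlim : Tendsto (fun h : ℝ => ∫⁻ x, ‖(h⁻¹ • ∫ t in (-h)..0, DK (x + t • e₂)).smulRight v - (DK x).smulRight v‖ₑ ^ 2)
      (𝓝[>] 0) (𝓝 0) := by
    have hle : ∀ h : ℝ, (∫⁻ x, ‖(h⁻¹ • ∫ t in (-h)..0, DK (x + t • e₂)).smulRight v - (DK x).smulRight v‖ₑ ^ 2) ≤
        ENNReal.ofReal (‖v‖ ^ 2) * ∫⁻ x, ‖(h⁻¹ • ∫ t in (-h)..0, DK (x + t • e₂)) - DK x‖ₑ ^ 2 := by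
      intro h
      rw [← lintegral_const_mul' _ _ ENNReal.ofReal_ne_top]
      refine lintegral_mono fun x => le_of_eq ?_
      have hn : ‖((h⁻¹ • ∫ t in (-h)..0, DK (x + t • e₂)) - DK x).smulRight v‖ =
          ‖(h⁻¹ • ∫ t in (-h)..0, DK (x + t • e₂)) - DK x‖ * ‖v‖ := ContinuousLinearMap.norm_smulRight_apply _ _
      rw [← sub_smulRight, ← ofReal_norm, ← ofReal_norm, hn, ← ENNReal.ofReal_pow (by positivity),
        ← ENNReal.ofReal_pow (norm_nonneg _), ← ENNReal.ofReal_mul (sq_nonneg _)]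
      congr 1
      ring
    have h0 : Tendsto (fun h : ℝ => ENNReal.ofReal (‖v‖ ^ 2) * ∫⁻ x, ‖(h⁻¹ • ∫ t in (-h)..0, DK (x + t • e₂)) - DK x‖ₑ ^ 2)
        (𝓝[>] 0) (𝓝 0) := by
      have := ENNReal.Tendsto.const_mul (a := ENNReal.ofReal (‖v‖ ^ 2)) hlim0 (Or.inr ENNReal.ofReal_ne_top)
      rwa [mul_zero] at this
    exact tendsto_of_tendsto_of_tendsto_of_le_of_le tendsto_const_nhds h0 (fun _ => bot_le) hle
  exact tendsto_integral_sum_inner_apply (l := 𝓝[>] (0 : ℝ)) cD mD hΨc hΨm cΨ₀ mΨ₀ hlim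

/-- **(R4′c) the sliding-average term passes to the limit**:
`∫Σᵢ⟪∂ᵢω, h⁻¹T_{bᵢ}(x)⟫ → ∫Σᵢ⟪∂ᵢω, (DK₁(x)bᵢ)e₀ − (DK₀(x)bᵢ)e₁⟫`, `Kⱼ = ∂ⱼ(g′V₂)` (`DKⱼ ∈ L²`, …SlideAverage).
[folklore] -/
theorem tendsto_palinstrophyRemainderT (hV : ContDiff ℝ ∞ V) (hg : ContDiff ℝ ∞ g) {T K1 K2 K3 : ℝ}
    (hK1 : ∀ s, |deriv g s| ≤ K1) (hK2 : ∀ s, |deriv (deriv g) s| ≤ K2) (hK3 : ∀ s, |deriv (deriv (deriv g)) s| ≤ K3)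
    (hT2 : ∀ s, T < |s| → deriv (deriv g) s = 0) (hT3 : ∀ s, T < |s| → deriv (deriv (deriv g)) s = 0)
    (h1 : ∫⁻ x, ‖iteratedFDeriv ℝ 1 V x‖ₑ ^ 2 < ⊤) (h2 : ∫⁻ x, ‖iteratedFDeriv ℝ 2 V x‖ₑ ^ 2 < ⊤)
    (hslab : Integrable (fun x => {x : EuclideanSpace ℝ (Fin 3) | |x 2| ≤ T}.indicator (fun x => ‖V x‖ ^ 2) x) volume) :
    Tendsto (fun h : ℝ => ∫ x, ∑ i : Fin 3, ⟪fderiv ℝ (curl V) x (EuclideanSpace.basisFun (Fin 3) ℝ i),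
        h⁻¹ • ((∫ t in (-h)..0, fderiv ℝ (fun y : EuclideanSpace ℝ (Fin 3) => fderiv ℝ (fun z : EuclideanSpace ℝ (Fin 3) => deriv g (z 2) * V z 2) y (EuclideanSpace.single (1 : Fin 3) (1 : ℝ))) (x + t • EuclideanSpace.single (2 : Fin 3) (1 : ℝ)) (EuclideanSpace.basisFun (Fin 3) ℝ i)) • EuclideanSpace.single (0 : Fin 3) (1 : ℝ) -
            (∫ t in (-h)..0, fderiv ℝ (fun y : EuclideanSpace ℝ (Fin 3) => fderiv ℝ (fun z : EuclideanSpace ℝ (Fin 3) => deriv g (z 2) * V z 2) y (EuclideanSpace.single (0 : Fin 3) (1 : ℝ))) (x + t • EuclideanSpace.single (2 : Fin 3) (1 : ℝ)) (EuclideanSpace.basisFun (Fin 3) ℝ i)) • EuclideanSpace.single (1 : Fin 3) (1 : ℝ))⟫) (𝓝[>] 0)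
      (𝓝 (∫ x, ∑ i : Fin 3, ⟪fderiv ℝ (curl V) x (EuclideanSpace.basisFun (Fin 3) ℝ i),
        (fderiv ℝ (fun y : EuclideanSpace ℝ (Fin 3) => fderiv ℝ (fun z : EuclideanSpace ℝ (Fin 3) => deriv g (z 2) * V z 2) y (EuclideanSpace.single (1 : Fin 3) (1 : ℝ))) x (EuclideanSpace.basisFun (Fin 3) ℝ i)) • EuclideanSpace.single (0 : Fin 3) (1 : ℝ) -
          (fderiv ℝ (fun y : EuclideanSpace ℝ (Fin 3) => fderiv ℝ (fun z : EuclideanSpace ℝ (Fin 3) => deriv g (z 2) * V z 2) y (EuclideanSpace.single (0 : Fin 3) (1 : ℝ))) x (EuclideanSpace.basisFun (Fin 3) ℝ i)) • EuclideanSpace.single (1 : Fin 3) (1 : ℝ)⟫)) := by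
  set e₂ : EuclideanSpace ℝ (Fin 3) := EuclideanSpace.single (2 : Fin 3) (1 : ℝ) with he₂
  set e₁ : EuclideanSpace ℝ (Fin 3) := EuclideanSpace.single (1 : Fin 3) (1 : ℝ) with he₁
  set e₀ : EuclideanSpace ℝ (Fin 3) := EuclideanSpace.single (0 : Fin 3) (1 : ℝ) with he₀
  set b := EuclideanSpace.basisFun (Fin 3) ℝ with hb
  set DK₁ : EuclideanSpace ℝ (Fin 3) → (EuclideanSpace ℝ (Fin 3) →L[ℝ] ℝ) :=
    fderiv ℝ (fun y : EuclideanSpace ℝ (Fin 3) => fderiv ℝ (fun z : EuclideanSpace ℝ (Fin 3) => deriv g (z 2) * V z 2) y e₁) with hDK₁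
  set DK₀ : EuclideanSpace ℝ (Fin 3) → (EuclideanSpace ℝ (Fin 3) →L[ℝ] ℝ) :=
    fderiv ℝ (fun y : EuclideanSpace ℝ (Fin 3) => fderiv ℝ (fun z : EuclideanSpace ℝ (Fin 3) => deriv g (z 2) * V z 2) y e₀) with hDK₀
  obtain ⟨cD, mD⟩ := memLp_fderiv_curl hV h2
  obtain ⟨c₁, m₁⟩ := memLp_fderiv_slideCoeffDeriv hV hg hK1 hK2 hK3 hT2 hT3 h1 h2 hslab e₁
  obtain ⟨c₀, m₀⟩ := memLp_fderiv_slideCoeffDeriv hV hg hK1 hK2 hK3 hT2 hT3 h1 h2 hslab e₀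
  have T₁ := tendsto_integral_sum_inner_verticalAverage_smulRight hV h2 c₁ m₁ e₀
  have T₀ := tendsto_integral_sum_inner_verticalAverage_smulRight hV h2 c₀ m₀ e₁
  have T := T₁.sub T₀
  -- integrability of the four pairings (to split / recombine the integrals)
  obtain ⟨cΨ₁, mΨ₁⟩ := memLp_smulRight_const c₁ m₁ e₀
  obtain ⟨cΨ₀, mΨ₀⟩ := memLp_smulRight_const c₀ m₀ e₁
  have lim_eq : (∫ x, ∑ i : Fin 3, ⟪fderiv ℝ (curl V) x (b i), ((DK₁ x).smulRight e₀) (b i)⟫) -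
      (∫ x, ∑ i : Fin 3, ⟪fderiv ℝ (curl V) x (b i), ((DK₀ x).smulRight e₁) (b i)⟫) =
      ∫ x, ∑ i : Fin 3, ⟪fderiv ℝ (curl V) x (b i), (DK₁ x (b i)) • e₀ - (DK₀ x (b i)) • e₁⟫ := by
    rw [← integral_sub (integrable_sum_inner_apply cD cΨ₁ mD mΨ₁) (integrable_sum_inner_apply cD cΨ₀ mD mΨ₀)]
    refine integral_congr_ae (Eventually.of_forall fun x => ?_)
    dsimp only
    rw [← Finset.sum_sub_distrib]
    refine Finset.sum_congr rfl fun i _ => ?_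
    rw [← inner_sub_right, ContinuousLinearMap.smulRight_apply, ContinuousLinearMap.smulRight_apply]
  rw [lim_eq] at T
  refine T.congr' ?_
  filter_upwards [eventually_mem_nhdsWithin] with h hh
  have hpos : 0 < h := hh
  obtain ⟨cA₁, mA₁⟩ := memLp_verticalAverage c₁ m₁ hpos
  obtain ⟨cA₀, mA₀⟩ := memLp_verticalAverage c₀ m₀ hpos
  obtain ⟨cΦ₁, mΦ₁⟩ := memLp_smulRight_const cA₁ mA₁ e₀
  obtain ⟨cΦ₀, mΦ₀⟩ := memLp_smulRight_const cA₀ mA₀ e₁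
  rw [← integral_sub (integrable_sum_inner_apply cD cΦ₁ mD mΦ₁) (integrable_sum_inner_apply cD cΦ₀ mD mΦ₀)]
  refine integral_congr_ae (Eventually.of_forall fun x => ?_)
  dsimp only
  rw [← Finset.sum_sub_distrib]
  refine Finset.sum_congr rfl fun i _ => ?_
  have i₁ : IntervalIntegrable (fun t : ℝ => DK₁ (x + t • e₂)) volume (-h) 0 :=
    (c₁.comp (continuous_const.add (continuous_id.smul continuous_const))).intervalIntegrable _ _
  have i₀ : IntervalIntegrable (fun t : ℝ => DK₀ (x + t • e₂)) volume (-h) 0 :=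
    (c₀.comp (continuous_const.add (continuous_id.smul continuous_const))).intervalIntegrable _ _
  rw [← inner_sub_right, ContinuousLinearMap.smulRight_apply, ContinuousLinearMap.smulRight_apply, smul_apply, smul_apply,
    ContinuousLinearMap.intervalIntegral_apply i₁, ContinuousLinearMap.intervalIntegral_apply i₀, smul_sub, smul_smul,
    smul_smul, smul_eq_mul, smul_eq_mul]

/-! ## 3. Assembly: the palinstrophy bound is unconditional, and its right side converges -/

/-- **The palinstrophy bound along the discrete slide, unconditional form** (`hR`, `hT` discharged): for every `h > 0`,
`c₁(ψ_h) ≤ −½∫(D₋ₕg)|Dω|²_F − ∫Σᵢ⟪∂ᵢω, h⁻¹(R(x)−R(x−he₂))bᵢ⟫ + ∫Σᵢ⟪∂ᵢω, h⁻¹T_{bᵢ}(x)⟫`. [folklore] -/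
theorem palinstrophy_slideQuotient_le' (hV : ContDiff ℝ ∞ V) (hg : ContDiff ℝ ∞ g) {T K0 K1 K2 K3 : ℝ}
    (hK0 : ∀ s, |g s| ≤ K0) (hK1 : ∀ s, |deriv g s| ≤ K1) (hK2 : ∀ s, |deriv (deriv g) s| ≤ K2)
    (hK3 : ∀ s, |deriv (deriv (deriv g)) s| ≤ K3)
    (hT2 : ∀ s, T < |s| → deriv (deriv g) s = 0) (hT3 : ∀ s, T < |s| → deriv (deriv (deriv g)) s = 0)
    (hg0 : ∀ s, 0 ≤ g s)
    (h1 : ∫⁻ x, ‖iteratedFDeriv ℝ 1 V x‖ₑ ^ 2 < ⊤) (h2 : ∫⁻ x, ‖iteratedFDeriv ℝ 2 V x‖ₑ ^ 2 < ⊤)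
    (hslab : Integrable (fun x => {x : EuclideanSpace ℝ (Fin 3) | |x 2| ≤ T}.indicator (fun x => ‖V x‖ ^ 2) x) volume)
    {h : ℝ} (hh : 0 < h) :
    ∫ x, ∑ i : Fin 3, ⟪fderiv ℝ (curl V) x (EuclideanSpace.basisFun (Fin 3) ℝ i),
        fderiv ℝ (curl (fun x : EuclideanSpace ℝ (Fin 3) => (-h⁻¹) • (g (x 2) • V x - g ((x + (-h) • EuclideanSpace.single (2 : Fin 3) (1 : ℝ)) 2) • V (x + (-h) • EuclideanSpace.single (2 : Fin 3) (1 : ℝ)) - (∫ t in (-h)..0, deriv g ((x + t • EuclideanSpace.single (2 : Fin 3) (1 : ℝ)) 2) * V (x + t • EuclideanSpace.single (2 : Fin 3) (1 : ℝ)) 2) • EuclideanSpace.single (2 : Fin 3) (1 : ℝ)))) x (EuclideanSpace.basisFun (Fin 3) ℝ i)⟫ ≤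
      -((1 / 2) * ∫ x, (h⁻¹ * (g (x 2) - g (x 2 - h))) * frobeniusNormSq (fderiv ℝ (curl V) x)) -
        (∫ x, ∑ i : Fin 3, ⟪fderiv ℝ (curl V) x (EuclideanSpace.basisFun (Fin 3) ℝ i),
          h⁻¹ • ((fderiv ℝ (curl (fun z : EuclideanSpace ℝ (Fin 3) => g (z 2) • V z)) x (EuclideanSpace.basisFun (Fin 3) ℝ i) - g (x 2) • fderiv ℝ (curl V) x (EuclideanSpace.basisFun (Fin 3) ℝ i)) -
            (fderiv ℝ (curl (fun z : EuclideanSpace ℝ (Fin 3) => g (z 2) • V z)) (x + (-h) • EuclideanSpace.single (2 : Fin 3) (1 : ℝ)) (EuclideanSpace.basisFun (Fin 3) ℝ i) -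
              g (x 2 - h) • fderiv ℝ (curl V) (x + (-h) • EuclideanSpace.single (2 : Fin 3) (1 : ℝ)) (EuclideanSpace.basisFun (Fin 3) ℝ i)))⟫) +
        ∫ x, ∑ i : Fin 3, ⟪fderiv ℝ (curl V) x (EuclideanSpace.basisFun (Fin 3) ℝ i), h⁻¹ • ((∫ t in (-h)..0, fderiv ℝ (fun y : EuclideanSpace ℝ (Fin 3) => fderiv ℝ (fun z : EuclideanSpace ℝ (Fin 3) => deriv g (z 2) * V z 2) y (EuclideanSpace.single (1 : Fin 3) (1 : ℝ))) (x + t • EuclideanSpace.single (2 : Fin 3) (1 : ℝ)) (EuclideanSpace.basisFun (Fin 3) ℝ i)) • EuclideanSpace.single (0 : Fin 3) (1 : ℝ) -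
            (∫ t in (-h)..0, fderiv ℝ (fun y : EuclideanSpace ℝ (Fin 3) => fderiv ℝ (fun z : EuclideanSpace ℝ (Fin 3) => deriv g (z 2) * V z 2) y (EuclideanSpace.single (0 : Fin 3) (1 : ℝ))) (x + t • EuclideanSpace.single (2 : Fin 3) (1 : ℝ)) (EuclideanSpace.basisFun (Fin 3) ℝ i)) • EuclideanSpace.single (1 : Fin 3) (1 : ℝ))⟫ :=
  palinstrophy_slideQuotient_le hV hg h2 hK0 hg0 hh
    (integrable_palinstrophyRemainderR hV hg hK1 hK2 hK3 hT2 hT3 h1 h2 hslab h)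
    (integrable_palinstrophyRemainderT hV hg hK1 hK2 hK3 hT2 hT3 h1 h2 hslab hh)

/-- **The right side of the palinstrophy bound converges as `h → 0⁺`** to
`ĉ₁ = −½∫g′|Dω|²_F − ∫Σᵢ⟪∂ᵢω, (∂₂R)bᵢ⟫ + ∫Σᵢ⟪∂ᵢω, (DK₁bᵢ)e₀ − (DK₀bᵢ)e₁⟫` (the regularised palinstrophy variation
along the slide; record §13, R4′). [folklore] -/
theorem tendsto_palinstrophy_slideQuotient_rhs (hV : ContDiff ℝ ∞ V) (hg : ContDiff ℝ ∞ g) {T K1 K2 K3 : ℝ}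
    (hK1 : ∀ s, |deriv g s| ≤ K1) (hK2 : ∀ s, |deriv (deriv g) s| ≤ K2) (hK3 : ∀ s, |deriv (deriv (deriv g)) s| ≤ K3)
    (hT2 : ∀ s, T < |s| → deriv (deriv g) s = 0) (hT3 : ∀ s, T < |s| → deriv (deriv (deriv g)) s = 0)
    (h1 : ∫⁻ x, ‖iteratedFDeriv ℝ 1 V x‖ₑ ^ 2 < ⊤) (h2 : ∫⁻ x, ‖iteratedFDeriv ℝ 2 V x‖ₑ ^ 2 < ⊤)
    (hslab : Integrable (fun x => {x : EuclideanSpace ℝ (Fin 3) | |x 2| ≤ T}.indicator (fun x => ‖V x‖ ^ 2) x) volume) :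
    Tendsto (fun h : ℝ =>
      -((1 / 2) * ∫ x, (h⁻¹ * (g (x 2) - g (x 2 - h))) * frobeniusNormSq (fderiv ℝ (curl V) x)) -
        (∫ x, ∑ i : Fin 3, ⟪fderiv ℝ (curl V) x (EuclideanSpace.basisFun (Fin 3) ℝ i),
          h⁻¹ • ((fderiv ℝ (curl (fun z : EuclideanSpace ℝ (Fin 3) => g (z 2) • V z)) x (EuclideanSpace.basisFun (Fin 3) ℝ i) - g (x 2) • fderiv ℝ (curl V) x (EuclideanSpace.basisFun (Fin 3) ℝ i)) -
            (fderiv ℝ (curl (fun z : EuclideanSpace ℝ (Fin 3) => g (z 2) • V z)) (x + (-h) • EuclideanSpace.single (2 : Fin 3) (1 : ℝ)) (EuclideanSpace.basisFun (Fin 3) ℝ i) -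
              g (x 2 - h) • fderiv ℝ (curl V) (x + (-h) • EuclideanSpace.single (2 : Fin 3) (1 : ℝ)) (EuclideanSpace.basisFun (Fin 3) ℝ i)))⟫) +
        ∫ x, ∑ i : Fin 3, ⟪fderiv ℝ (curl V) x (EuclideanSpace.basisFun (Fin 3) ℝ i), h⁻¹ • ((∫ t in (-h)..0, fderiv ℝ (fun y : EuclideanSpace ℝ (Fin 3) => fderiv ℝ (fun z : EuclideanSpace ℝ (Fin 3) => deriv g (z 2) * V z 2) y (EuclideanSpace.single (1 : Fin 3) (1 : ℝ))) (x + t • EuclideanSpace.single (2 : Fin 3) (1 : ℝ)) (EuclideanSpace.basisFun (Fin 3) ℝ i)) • EuclideanSpace.single (0 : Fin 3) (1 : ℝ) -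
            (∫ t in (-h)..0, fderiv ℝ (fun y : EuclideanSpace ℝ (Fin 3) => fderiv ℝ (fun z : EuclideanSpace ℝ (Fin 3) => deriv g (z 2) * V z 2) y (EuclideanSpace.single (0 : Fin 3) (1 : ℝ))) (x + t • EuclideanSpace.single (2 : Fin 3) (1 : ℝ)) (EuclideanSpace.basisFun (Fin 3) ℝ i)) • EuclideanSpace.single (1 : Fin 3) (1 : ℝ))⟫)
      (𝓝[>] 0)
      (𝓝 (-((1 / 2) * ∫ x, deriv g (x 2) * frobeniusNormSq (fderiv ℝ (curl V) x)) -
        (∫ x, ∑ i : Fin 3, ⟪fderiv ℝ (curl V) x (EuclideanSpace.basisFun (Fin 3) ℝ i),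
          (fderiv ℝ (fun y : EuclideanSpace ℝ (Fin 3) =>
            fderiv ℝ (curl (fun z : EuclideanSpace ℝ (Fin 3) => g (z 2) • V z)) y - g (y 2) • fderiv ℝ (curl V) y) x
            (EuclideanSpace.single (2 : Fin 3) (1 : ℝ))) (EuclideanSpace.basisFun (Fin 3) ℝ i)⟫) +
        ∫ x, ∑ i : Fin 3, ⟪fderiv ℝ (curl V) x (EuclideanSpace.basisFun (Fin 3) ℝ i),
          (fderiv ℝ (fun y : EuclideanSpace ℝ (Fin 3) => fderiv ℝ (fun z : EuclideanSpace ℝ (Fin 3) => deriv g (z 2) * V z 2) y (EuclideanSpace.single (1 : Fin 3) (1 : ℝ))) x (EuclideanSpace.basisFun (Fin 3) ℝ i)) • EuclideanSpace.single (0 : Fin 3) (1 : ℝ) -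
            (fderiv ℝ (fun y : EuclideanSpace ℝ (Fin 3) => fderiv ℝ (fun z : EuclideanSpace ℝ (Fin 3) => deriv g (z 2) * V z 2) y (EuclideanSpace.single (0 : Fin 3) (1 : ℝ))) x (EuclideanSpace.basisFun (Fin 3) ℝ i)) • EuclideanSpace.single (1 : Fin 3) (1 : ℝ)⟫)) :=
  (((tendsto_palinstrophyWeight hV hg hK1 hK2 h2).const_mul (1 / 2)).neg.sub
    (tendsto_palinstrophyRemainderR hV hg hK1 hK2 hK3 hT2 hT3 h1 h2 hslab)).add
    (tendsto_palinstrophyRemainderT hV hg hK1 hK2 hK3 hT2 hT3 h1 h2 hslab)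

end ExtremiserLiouville

end Summit.NavierStokesRegularity.NavierStokesRegularity.Theorems

end
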